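import Literature.NumberTheory.ConnesConsani2021.ArchKernelModesMI
import Literature.NumberTheory.ConnesConsani2021.EpsSlopeKernel
import Literature.NumberTheory.ConnesConsani2021.EpsSlopeFrobeniusSeries
import Literature.NumberTheory.ConnesConsani2021.EpsSlopeFrobeniusBridge
import HarnessLib

/-!
# Connes–Consani 2021 §5–§6, the (E-a) kernel certificate — SOUNDNESS of module K1 `ArchKernelModesMI`
# (Part A: interval soundness · Part B: tails and the bridge to real statements · Part C: the per-mode package · Parts D/D-2/E: decoding and identification data)

RH-FREE (label, line 1).  bears_on (cell rh-crit, corpus C1): route «ConnesConsaniSemilocal» item K3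
`WindowSpectralBound` (stmt 19306) — the (E-a) conjunct of `CC2021_section6_enclosures`, via seat t7's frame
`section6_enclosures_of_uniformVpanels_of_majorant`; Tier-2 piece (P1-sound) of cc-lead R112/R113 for the
ENGINE module `ArchKernelModesMI` of rh-crit-cc-eng-1 g2 (defs + `modesCheck_eq_true` by `decide +kernel`, scale
`S = 2^128`).  WHAT THIS FILE PROVES (theorems only — no `def`, no named fact): for the computable `MI` objects of
`ArchKernelModesMI` and EVERY real `χ` in a bracket `chi`,
* Part A — `mem_frobCoeffMI` (the real Frobenius coefficient `a_k(χ) = frobCoeff 1 χ k` of `ProlateFrobenius` lies in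
  `frobCoeffMI chi k`, by induction on the verbatim interval recursion), `mem_sumMI`, `mem_u0MI`, `mem_wMI`, `mem_iMI`,
  `mem_dMI` (the finite sums `Σ a_k`, `Σ k a_k`, `Σ a_k/(k+1)`, `ΣΣ a_i a_j/(i+j+1)`), and the read-back of the thin-end
  sign test `pos_of_signNegDerivAt` / `neg_of_signNegDerivAt`;
* Part B — `tailCheckMI_spec`, `geometric_of_tailCheckMI` (R1: `|a_k(χ)| ≤ Bnum·S⁻¹·(13/20)ᵏ` for `k ≥ K`, from the
  three base inequalities, `|4π² − χ| ≤ c` and the rational criterion `critQ`, via the recursion-induction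
  `SlopeCert.abs_frobCoeff_le_geometric` of `EpsSlopeKernel`), `tail_le_T` / `tail_le_DT`, (R2)
  `abs_frobSol_zero_sub_sum_le_of_tailCheckMI : |u(0) − Σ_{k≤K} a_k| ≤ T/S`, (R3)
  `abs_frobSol₁_zero_add_sum_le_of_tailCheckMI : |u′(0) + Σ_{k≤K} k a_k| ≤ DT/S` (`u = frobSol 1 χ`,
  `u′ = frobSol₁ 1 χ`), the truncation bounds on the WHOLE disc of convergence used downstream
  (`abs_frobSol_sub_sum_le_of_tailCheckMI`, `|1 − y| ≤ 1`), the certified end signs `endSigns_of_checks`, the bundle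
  `bracketFacts_of_checks`, `summable_abs_tail_le_T`, `sum_abs_mul_S_le_sAbs`;
* Part C — `exists_critical_of_checks` (IVT ⇒ a critical `b` in the bracket), `mem_modeEncl` (`u(0), ∫₀¹u, ∫₀¹u²`
  in the three widened intervals), `mem_modeQuantities` (`(2∫u/u(0))², 1/(2∫u²)`, their product and
  `2L²/(1−L²)·1/(2∫u²)` in the four quotient intervals) and `mode_package` (the tree's `prolateEigen k ^ 2`,
  `prolateFun k 1 ^ 2`, their product and `epsSlopeTerm (prolateFun k)` for the member `k` = zero count of `u_b`);
* Part D — the cheap half of the decoding of `modesCheck_eq_true` per mode of record (`checks_of_mem_modes`,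
  `chiLo_le_chiHi_of_mem_modes`, `exists_critical_of_mem_modes`, `mode_package_of_mem_modes`);
* Part D-2 — the decoding of `totals`/`slopeFineCheck` in ONE declaration `slopeFine_decoded` (one more kernel
  evaluation of the eight modes, ≈ 45 s), `modeQuantities_isSome_of_mem_modes`, the generic read-back `mem_totals`
  (indexed sums over `j < 8`) and `slopeFine_real` (the six real inputs of the index-free tail frame);
* Part E — the bracket data of record in the hypothesis shapes `(hle) (hsign) (hsep) (htop)` of the identification
  lemma `exists_critical_prolateFun_eq_frobEvenExt` (N = 8): `modes_lo_le_hi`, `modes_endSigns`, `modes_sep`,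
  `modes_top`.
This is the `MI`/`S = 2^128` twin of the `FI`/`2^48` chain `EpsSlopeKernel` Part B–C + `EpsSlopeEnclosure.mode_package`
(same seat lineage gm-t16 / t15 / eng-1), whose purely real lemmas (`RecCrit`, `recCrit_mono`,
`abs_frobCoeff_le_geometric`, `tsum_tail_abs_le`, `tsum_tail_linear_abs_le`, `pi_sq_le`) are REUSED, not restated.
Source of the numbers being certified: A. Connes, C. Consani, *Weil positivity and trace formula, the archimedean
place*, Selecta Math. 27 (2021), Prop. 5.3 / Lemma 5.4 §5 pp. 32–33 and §6.3–6.4 p. 24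
[cite: ConnesConsani2021, Prop. 5.3 / Lemma 5.4 §5 pp. 32–33 and §6.3–6.4 p. 24]; the Frobenius method
[cite: CoddingtonLevinson1955, Ch. 4 §8].  Nothing here mentions ζ or RH; nothing here bears on the truth of RH.
-/

noncomputable section

namespace Literature.NumberTheory.ConnesConsani2021.ArchCert

open Literature.Analysis.ValidatedNumerics.NumericsMP Literature.NumberTheory.LFunctions Finset Real Set
open MeasureTheory intervalIntegral

/-! ## Part A — interval soundness of the recursion, of the finite sums, and of the sign test -/

/-- `π² ∈ pi2I`. [cite: ConnesConsani2021, Prop. 5.3 / Lemma 5.4 §5 pp. 32–33 and §6.3–6.4 p. 24 (in-kernel certificate for the §6 kernel enclosure)] -/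
theorem mem_pi2I : MI.mem S (π ^ 2) pi2I := MI.mem_sqr S_pos mem_piI

/-- `4π² ∈ fourPi2I`. [cite: ConnesConsani2021, Prop. 5.3 / Lemma 5.4 §5 pp. 32–33 and §6.3–6.4 p. 24 (in-kernel certificate for the §6 kernel enclosure)] -/
theorem mem_fourPi2I : MI.mem S (4 * π ^ 2) fourPi2I := by
  have h := MI.mem_mulInt mem_pi2I 4
  simpa [fourPi2I, mul_comm] using h

/-- `8π² ∈ eightPi2I`. [cite: ConnesConsani2021, Prop. 5.3 / Lemma 5.4 §5 pp. 32–33 and §6.3–6.4 p. 24 (in-kernel certificate for the §6 kernel enclosure)] -/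
theorem mem_eightPi2I : MI.mem S (8 * π ^ 2) eightPi2I := by
  have h := MI.mem_mulInt mem_pi2I 8
  simpa [eightPi2I, mul_comm] using h

/-- Transport of membership along an equality of reals. [cite: ConnesConsani2021, Prop. 5.3 / Lemma 5.4 §5 pp. 32–33 and §6.3–6.4 p. 24 (in-kernel certificate for the §6 kernel enclosure)] -/
theorem mem_of_eq {x y : ℝ} {I : MI} (h : x = y) (hx : MI.mem S x I) : MI.mem S y I := h ▸ hx

/-- **Soundness of the interval recursion**: for every real `χ` in the interval `chi`, the Frobenius
triple `(a_{k−2}, a_{k−1}, a_k)(χ)` of `ProlateFrobenius` (at `λ = 1`) lies in `frobTripleMI chi k`.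
[cite: CoddingtonLevinson1955, Ch. 4 §8] -/
theorem mem_frobTripleMI {χ : ℝ} {chi : MI} (hχ : MI.mem S χ chi) (k : ℕ) :
    MI.mem S (frobPrev₂ 1 χ k) (frobTripleMI chi k).1 ∧ MI.mem S (frobPrev 1 χ k) (frobTripleMI chi k).2.1 ∧
      MI.mem S (frobCoeff 1 χ k) (frobTripleMI chi k).2.2 := by
  induction k with
  | zero =>
    refine ⟨?_, ?_, ?_⟩
    · simpa [frobTripleMI] using MI.mem_ofInt S 0
    · simpa [frobTripleMI] using MI.mem_ofInt S 0
    · simpa [frobTripleMI] using MI.mem_ofInt S 1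
  | succ k ih =>
    obtain ⟨h1, h2, h3⟩ := ih
    refine ⟨?_, ?_, ?_⟩
    · simpa [frobTripleMI] using h2
    · simpa [frobTripleMI] using h3
    · -- the new coefficient
      have hk : MI.mem S (((k : ℤ) * (k + 1) : ℤ) : ℝ) (MI.ofInt S ((k : ℤ) * (k + 1))) := MI.mem_ofInt S _
      have hnum := MI.mem_add
        (MI.mem_sub (MI.mem_mul S_pos (MI.mem_add (MI.mem_sub hk hχ) mem_fourPi2I) h3)
          (MI.mem_mul S_pos mem_eightPi2I h2))
        (MI.mem_mul S_pos mem_fourPi2I h1)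
      have hpos : 0 < 2 * (k + 1) ^ 2 := by positivity
      have hdiv := MI.mem_divNat hnum hpos
      refine mem_of_eq ?_ (by simpa [frobTripleMI] using hdiv)
      rw [frobCoeff_succ]
      ring

/-- `a_k(χ) ∈ A_k = frobCoeffMI chi k`. [cite: CoddingtonLevinson1955, Ch. 4 §8] -/
theorem mem_frobCoeffMI {χ : ℝ} {chi : MI} (hχ : MI.mem S χ chi) (k : ℕ) :
    MI.mem S (frobCoeff 1 χ k) (frobCoeffMI chi k) :=
  (mem_frobTripleMI hχ k).2.2

/-- Soundness of `sumMI`: finite sums of members are members. [cite: ConnesConsani2021, Prop. 5.3 / Lemma 5.4 §5 pp. 32–33 and §6.3–6.4 p. 24 (in-kernel certificate for the §6 kernel enclosure)] -/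
theorem mem_sumMI {f : ℕ → ℝ} {F : ℕ → MI} (h : ∀ k, MI.mem S (f k) (F k)) (n : ℕ) :
    MI.mem S (∑ k ∈ range n, f k) (sumMI F n) := by
  induction n with
  | zero => simpa [sumMI] using MI.mem_ofInt S 0
  | succ n ih =>
    rw [sum_range_succ]
    exact MI.mem_add ih (h n)

/-- `Σ_{k<n} a_k(χ) ∈ u0MI chi n`. [cite: ConnesConsani2021, Prop. 5.3 / Lemma 5.4 §5 pp. 32–33 and §6.3–6.4 p. 24 (in-kernel certificate for the §6 kernel enclosure)] -/
theorem mem_u0MI {χ : ℝ} {chi : MI} (hχ : MI.mem S χ chi) (n : ℕ) :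
    MI.mem S (∑ k ∈ range n, frobCoeff 1 χ k) (u0MI chi n) :=
  mem_sumMI (mem_frobCoeffMI hχ) n

/-- `Σ_{k<n} k·a_k(χ) ∈ wMI chi n`. [cite: ConnesConsani2021, Prop. 5.3 / Lemma 5.4 §5 pp. 32–33 and §6.3–6.4 p. 24 (in-kernel certificate for the §6 kernel enclosure)] -/
theorem mem_wMI {χ : ℝ} {chi : MI} (hχ : MI.mem S χ chi) (n : ℕ) :
    MI.mem S (∑ k ∈ range n, frobCoeff 1 χ k * k) (wMI chi n) :=
  mem_sumMI (fun k ↦ by simpa using MI.mem_mulInt (mem_frobCoeffMI hχ k) (k : ℤ)) n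

/-- `Σ_{k<n} a_k(χ)/(k+1) ∈ iMI chi n`. [cite: ConnesConsani2021, Prop. 5.3 / Lemma 5.4 §5 pp. 32–33 and §6.3–6.4 p. 24 (in-kernel certificate for the §6 kernel enclosure)] -/
theorem mem_iMI {χ : ℝ} {chi : MI} (hχ : MI.mem S χ chi) (n : ℕ) :
    MI.mem S (∑ k ∈ range n, frobCoeff 1 χ k / (k + 1)) (iMI chi n) :=
  mem_sumMI (fun k ↦ by
    simpa using MI.mem_divNat (mem_frobCoeffMI hχ k) (Nat.succ_pos k)) n

/-- `Σ_{i,j<n} a_i a_j/(i+j+1) ∈ dMI chi n`. [cite: ConnesConsani2021, Prop. 5.3 / Lemma 5.4 §5 pp. 32–33 and §6.3–6.4 p. 24 (in-kernel certificate for the §6 kernel enclosure)] -/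
theorem mem_dMI {χ : ℝ} {chi : MI} (hχ : MI.mem S χ chi) (n : ℕ) :
    MI.mem S (∑ i ∈ range n, ∑ j ∈ range n, frobCoeff 1 χ i * frobCoeff 1 χ j / (i + j + 1)) (dMI chi n) :=
  mem_sumMI (fun i ↦ mem_sumMI (fun j ↦ by
    have h := MI.mem_divNat (MI.mem_mul S_pos (mem_frobCoeffMI hχ i) (mem_frobCoeffMI hχ j))
      (Nat.succ_pos (i + j))
    simpa [Nat.cast_add, Nat.cast_one, add_assoc] using h) n) n

/-- Reading the sign test: if `signNegDerivAt c K DT true` then every real `w` with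
`|w − Σ_{k≤K} k a_k(c·S⁻¹)|·S ≤ DT` is positive (used with `w = −u′(0; χ)` once the derivative tail is
bounded by `DT`). [cite: ConnesConsani2021, Prop. 5.3 / Lemma 5.4 §5 pp. 32–33 and §6.3–6.4 p. 24 (in-kernel certificate for the §6 kernel enclosure)] -/
theorem pos_of_signNegDerivAt {c : ℤ} {K DT : ℕ} (h : signNegDerivAt c K DT true = true) {w : ℝ}
    (hw : |w - ∑ k ∈ range (K + 1), frobCoeff 1 ((c : ℝ) / S) k * k| * S ≤ DT) : 0 < w := by
  have hχ : MI.mem S ((c : ℝ) / S) ⟨c, c⟩ := MI.mem_ofScaled S_pos c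
  have hmem := MI.mem_widen (mem_wMI hχ (K + 1)) (e := DT) hw
  simp only [signNegDerivAt, ite_true, decide_eq_true_eq] at h
  exact MI.pos_of_lo_pos hmem h

/-- The negative case of the sign test. [cite: ConnesConsani2021, Prop. 5.3 / Lemma 5.4 §5 pp. 32–33 and §6.3–6.4 p. 24 (in-kernel certificate for the §6 kernel enclosure)] -/
theorem neg_of_signNegDerivAt {c : ℤ} {K DT : ℕ} (h : signNegDerivAt c K DT false = true) {w : ℝ}
    (hw : |w - ∑ k ∈ range (K + 1), frobCoeff 1 ((c : ℝ) / S) k * k| * S ≤ DT) : w < 0 := by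
  have hχ : MI.mem S ((c : ℝ) / S) ⟨c, c⟩ := MI.mem_ofScaled S_pos c
  have hmem := MI.mem_widen (mem_wMI hχ (K + 1)) (e := DT) hw
  simp only [signNegDerivAt] at h
  exact MI.neg_of_hi_neg hmem (by simpa using h)

/-! ## Part B — tails and the bridge: kernel-decidable checks ⇒ real statements on each bracket -/

/-- `|Σ f| ≤ Σ |f|` for an absolutely summable real sequence. [folklore] -/
private theorem abs_tsum_le {f : ℕ → ℝ} (hf : Summable fun i ↦ |f i|) : |∑' i, f i| ≤ ∑' i, |f i| := by
  have h := norm_tsum_le_tsum_norm (f := f) (by simpa only [Real.norm_eq_abs] using hf)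
  simpa only [Real.norm_eq_abs] using h

set_option maxRecDepth 4000 in
/-- Unpacking a passed `tailCheckMI`. [cite: ConnesConsani2021, Prop. 5.3 / Lemma 5.4 §5 pp. 32–33 and §6.3–6.4 p. 24 (in-kernel certificate for the §6 kernel enclosure)] -/
theorem tailCheckMI_spec {chi : MI} {K : ℕ} {td : TailData} (h : tailCheckMI chi K td = true) :
    (frobCoeffMI chi K).absHi * 20 ^ K ≤ (td.Bnum : ℤ) * 13 ^ K ∧
    (frobCoeffMI chi (K + 1)).absHi * 20 ^ (K + 1) ≤ (td.Bnum : ℤ) * 13 ^ (K + 1) ∧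
    (frobCoeffMI chi (K + 2)).absHi * 20 ^ (K + 2) ≤ (td.Bnum : ℤ) * 13 ^ (K + 2) ∧
    fourPi2I.hi - chi.lo ≤ (td.c : ℤ) * S ∧ chi.hi - fourPi2I.lo ≤ (td.c : ℤ) * S ∧ critQ K td.c ∧
    20 * td.Bnum * 13 ^ (K + 1) ≤ 7 * td.T * 20 ^ (K + 1) ∧
    20 * td.Bnum * 13 ^ (K + 1) * (13 + 7 * (K + 1)) ≤ 49 * td.DT * 20 ^ (K + 1) := by
  simp only [tailCheckMI, Bool.and_eq_true, decide_eq_true_eq] at h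
  obtain ⟨⟨⟨⟨⟨⟨⟨h1, h2⟩, h3⟩, h4⟩, h5⟩, h6⟩, h7⟩, h8⟩ := h
  exact ⟨h1, h2, h3, h4, h5, h6, h7, h8⟩

/-- From a base check: `|a_k(χ)| ≤ B qᵏ` with `B = Bnum·S⁻¹`, `q = 13/20`. [cite: ConnesConsani2021, Prop. 5.3 / Lemma 5.4 §5 pp. 32–33 and §6.3–6.4 p. 24 (in-kernel certificate for the §6 kernel enclosure)] -/
theorem abs_le_of_base {χ : ℝ} {chi : MI} (hχ : MI.mem S χ chi) {Bnum k : ℕ}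
    (h : (frobCoeffMI chi k).absHi * 20 ^ k ≤ (Bnum : ℤ) * 13 ^ k) :
    |frobCoeff 1 χ k| ≤ (Bnum : ℝ) / S * (13 / 20) ^ k := by
  have h1 := MI.abs_le_absHi (mem_frobCoeffMI hχ k)
  have h2 : ((frobCoeffMI chi k).absHi : ℝ) * 20 ^ k ≤ (Bnum : ℝ) * 13 ^ k := by exact_mod_cast h
  have hS : (0 : ℝ) < (S : ℝ) := by exact_mod_cast S_pos
  have h20 : (0 : ℝ) < 20 ^ k := by positivity
  have key : |frobCoeff 1 χ k| * S * 20 ^ k ≤ (Bnum : ℝ) * 13 ^ k :=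
    le_trans (mul_le_mul_of_nonneg_right h1 h20.le) h2
  have e : (Bnum : ℝ) / S * (13 / 20) ^ k = (Bnum : ℝ) * 13 ^ k / (S * 20 ^ k) := by
    rw [div_pow]; field_simp
  rw [e, le_div_iff₀ (by positivity)]
  calc |frobCoeff 1 χ k| * (S * 20 ^ k) = |frobCoeff 1 χ k| * S * 20 ^ k := by ring
    _ ≤ _ := key

/-- From the `c`-check: `|4π² − χ| ≤ c` on the bracket. [cite: ConnesConsani2021, Prop. 5.3 / Lemma 5.4 §5 pp. 32–33 and §6.3–6.4 p. 24 (in-kernel certificate for the §6 kernel enclosure)] -/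
theorem abs_four_pi_sq_sub_le {χ : ℝ} {chi : MI} (hχ : MI.mem S χ chi) {c : ℕ}
    (h1 : fourPi2I.hi - chi.lo ≤ (c : ℤ) * S) (h2 : chi.hi - fourPi2I.lo ≤ (c : ℤ) * S) :
    |4 * π ^ 2 - χ| ≤ (c : ℝ) := by
  have hp := mem_fourPi2I
  have hS : (0 : ℝ) < (S : ℝ) := by exact_mod_cast S_pos
  have h1' : ((fourPi2I.hi : ℝ) - chi.lo) ≤ (c : ℝ) * S := by exact_mod_cast h1
  have h2' : ((chi.hi : ℝ) - fourPi2I.lo) ≤ (c : ℝ) * S := by exact_mod_cast h2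
  have hχ1 := hχ.1; have hχ2 := hχ.2; have hp1 := hp.1; have hp2 := hp.2
  have hup : (4 * π ^ 2 - χ) * S ≤ c * S := by nlinarith
  have hlo : (χ - 4 * π ^ 2) * S ≤ c * S := by nlinarith
  have hup' : 4 * π ^ 2 - χ ≤ c := le_of_mul_le_mul_right hup hS
  have hlo' : χ - 4 * π ^ 2 ≤ c := le_of_mul_le_mul_right hlo hS
  rw [abs_le]
  constructor <;> linarith

/-- From the rational criterion check (with `π² ≤ 9.87`): the real recursion criterion `SlopeCert.RecCrit` at `K + 2`.
[cite: ConnesConsani2021, Prop. 5.3 / Lemma 5.4 §5 pp. 32–33 and §6.3–6.4 p. 24 (in-kernel certificate for the §6 kernel enclosure)] -/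
theorem recCrit_of_critQ {K c : ℕ} (h : critQ K c) : SlopeCert.RecCrit c (13 / 20) (K + 2) := by
  unfold critQ at h
  unfold SlopeCert.RecCrit
  have h' := (Rat.cast_le (K := ℝ)).2 h
  push_cast at h' ⊢
  have hp := SlopeCert.pi_sq_le
  nlinarith

/-- **(R1) The geometric bound on the whole bracket** from a passed `tailCheckMI`:
`|a_k(χ)| ≤ Bnum·S⁻¹·(13/20)ᵏ` for all `k ≥ K` and every real `χ` in the bracket. [cite: ConnesConsani2021, Prop. 5.3 / Lemma 5.4 §5 pp. 32–33 and §6.3–6.4 p. 24 (in-kernel certificate for the §6 kernel enclosure)] -/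
theorem geometric_of_tailCheckMI {χ : ℝ} {chi : MI} (hχ : MI.mem S χ chi) {K : ℕ} {td : TailData}
    (h : tailCheckMI chi K td = true) :
    ∀ k, K ≤ k → |frobCoeff 1 χ k| ≤ (td.Bnum : ℝ) / S * (13 / 20) ^ k := by
  obtain ⟨hb0, hb1, hb2, hc1, hc2, hcrit, -, -⟩ := tailCheckMI_spec h
  refine SlopeCert.abs_frobCoeff_le_geometric (by norm_num) (by positivity) (abs_four_pi_sq_sub_le hχ hc1 hc2)
    (abs_le_of_base hχ hb0) (abs_le_of_base hχ hb1) (abs_le_of_base hχ hb2) ?_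
  exact SlopeCert.recCrit_mono (by norm_num) (recCrit_of_critQ hcrit)

/-- The `T` inequality read in `ℝ`: `B q^{K+1}/(1−q) ≤ T·S⁻¹`. [cite: ConnesConsani2021, Prop. 5.3 / Lemma 5.4 §5 pp. 32–33 and §6.3–6.4 p. 24 (in-kernel certificate for the §6 kernel enclosure)] -/
theorem tail_le_T {Bnum T K : ℕ} (h : 20 * Bnum * 13 ^ (K + 1) ≤ 7 * T * 20 ^ (K + 1)) :
    (Bnum : ℝ) / S * (13 / 20) ^ (K + 1) / (1 - 13 / 20) ≤ (T : ℝ) / S := by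
  have h' : (20 : ℝ) * Bnum * 13 ^ (K + 1) ≤ 7 * T * 20 ^ (K + 1) := by exact_mod_cast h
  have hS : (0 : ℝ) < (S : ℝ) := by exact_mod_cast S_pos
  have h20 : (0 : ℝ) < 20 ^ (K + 1) := by positivity
  have key : (Bnum : ℝ) * (13 / 20) ^ (K + 1) / (1 - 13 / 20) ≤ T := by
    have e : (Bnum : ℝ) * (13 / 20) ^ (K + 1) / (1 - 13 / 20)
        = 20 * Bnum * 13 ^ (K + 1) / (7 * 20 ^ (K + 1)) := by
      rw [div_pow]; field_simp; ring
    rw [e, div_le_iff₀ (by positivity)]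
    linarith
  calc (Bnum : ℝ) / S * (13 / 20) ^ (K + 1) / (1 - 13 / 20)
      = ((Bnum : ℝ) * (13 / 20) ^ (K + 1) / (1 - 13 / 20)) / S := by ring
    _ ≤ (T : ℝ) / S := div_le_div_of_nonneg_right key hS.le

/-- The `DT` inequality read in `ℝ`. [cite: ConnesConsani2021, Prop. 5.3 / Lemma 5.4 §5 pp. 32–33 and §6.3–6.4 p. 24 (in-kernel certificate for the §6 kernel enclosure)] -/
theorem tail_le_DT {Bnum DT K : ℕ}
    (h : 20 * Bnum * 13 ^ (K + 1) * (13 + 7 * (K + 1)) ≤ 49 * DT * 20 ^ (K + 1)) :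
    (Bnum : ℝ) / S * ((13 / 20) ^ (K + 1) * (13 / 20 + ((K + 1 : ℕ) : ℝ) * (1 - 13 / 20))
      / (1 - 13 / 20) ^ 2) ≤ (DT : ℝ) / S := by
  have h' : (20 : ℝ) * Bnum * 13 ^ (K + 1) * (13 + 7 * ((K : ℝ) + 1)) ≤ 49 * DT * 20 ^ (K + 1) := by
    exact_mod_cast h
  have hS : (0 : ℝ) < (S : ℝ) := by exact_mod_cast S_pos
  have h20 : (0 : ℝ) < 20 ^ (K + 1) := by positivity
  have key : (Bnum : ℝ) * ((13 / 20) ^ (K + 1) * (13 / 20 + ((K + 1 : ℕ) : ℝ) * (1 - 13 / 20))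
      / (1 - 13 / 20) ^ 2) ≤ DT := by
    have e : (Bnum : ℝ) * ((13 / 20) ^ (K + 1) * (13 / 20 + ((K + 1 : ℕ) : ℝ) * (1 - 13 / 20))
        / (1 - 13 / 20) ^ 2) = 20 * Bnum * 13 ^ (K + 1) * (13 + 7 * ((K : ℝ) + 1)) / (49 * 20 ^ (K + 1)) := by
      rw [div_pow]; push_cast; field_simp; ring
    rw [e, div_le_iff₀ (by positivity)]
    linarith
  calc (Bnum : ℝ) / S * ((13 / 20) ^ (K + 1) * (13 / 20 + ((K + 1 : ℕ) : ℝ) * (1 - 13 / 20))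
      / (1 - 13 / 20) ^ 2)
      = ((Bnum : ℝ) * ((13 / 20) ^ (K + 1) * (13 / 20 + ((K + 1 : ℕ) : ℝ) * (1 - 13 / 20))
      / (1 - 13 / 20) ^ 2)) / S := by ring
    _ ≤ (DT : ℝ) / S := div_le_div_of_nonneg_right key hS.le

/-- **The absolute tail is summable and `≤ T·S⁻¹`** on the bracket: `Σ_{k>K} |a_k(χ)| ≤ T/S`. [cite: ConnesConsani2021, Prop. 5.3 / Lemma 5.4 §5 pp. 32–33 and §6.3–6.4 p. 24 (in-kernel certificate for the §6 kernel enclosure)] -/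
theorem summable_abs_tail_le_T {χ : ℝ} {chi : MI} (hχ : MI.mem S χ chi) {K : ℕ} {td : TailData}
    (h : tailCheckMI chi K td = true) :
    Summable (fun k : ℕ ↦ |frobCoeff 1 χ (k + (K + 1))|) ∧
      ∑' k : ℕ, |frobCoeff 1 χ (k + (K + 1))| ≤ (td.T : ℝ) / S := by
  have hgeom := geometric_of_tailCheckMI hχ h
  obtain ⟨-, -, -, -, -, -, hT, -⟩ := tailCheckMI_spec h
  have hB : (0 : ℝ) ≤ (td.Bnum : ℝ) / S := by positivity
  obtain ⟨hs, hle⟩ := SlopeCert.tsum_tail_abs_le (y := 1) (by norm_num) (by norm_num) hB (by simp)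
    (K := K) (fun k hk ↦ hgeom k (by omega))
  simp only [abs_one, one_pow, mul_one] at hs hle
  exact ⟨hs, hle.trans (tail_le_T hT)⟩

/-- **The weighted tail is summable and `≤ DT·S⁻¹`** on the bracket: `Σ_{k>K} k|a_k(χ)| ≤ DT/S`. [cite: ConnesConsani2021, Prop. 5.3 / Lemma 5.4 §5 pp. 32–33 and §6.3–6.4 p. 24 (in-kernel certificate for the §6 kernel enclosure)] -/
theorem summable_linear_tail_le_DT {χ : ℝ} {chi : MI} (hχ : MI.mem S χ chi) {K : ℕ} {td : TailData}
    (h : tailCheckMI chi K td = true) :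
    Summable (fun k : ℕ ↦ ((k + (K + 1) : ℕ) : ℝ) * |frobCoeff 1 χ (k + (K + 1))|) ∧
      ∑' k : ℕ, ((k + (K + 1) : ℕ) : ℝ) * |frobCoeff 1 χ (k + (K + 1))| ≤ (td.DT : ℝ) / S := by
  have hgeom := geometric_of_tailCheckMI hχ h
  obtain ⟨-, -, -, -, -, -, -, hDT⟩ := tailCheckMI_spec h
  obtain ⟨hs, hle⟩ := SlopeCert.tsum_tail_linear_abs_le (by norm_num) (by norm_num) (K := K)
    (fun k hk ↦ hgeom k (by omega))
  exact ⟨hs, hle.trans (tail_le_DT hDT)⟩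

/-- **(R2) `u(0)` versus the finite sum**: for `χ` in the bracket, `|frobSol 1 χ 0 − Σ_{k≤K} a_k(χ)| ≤ T·S⁻¹`.
[cite: ConnesConsani2021, Prop. 5.3 / Lemma 5.4 §5 pp. 32–33 and §6.3–6.4 p. 24 (in-kernel certificate for the §6 kernel enclosure)] -/
theorem abs_frobSol_zero_sub_sum_le_of_tailCheckMI {χ : ℝ} {chi : MI} (hχ : MI.mem S χ chi) {K : ℕ}
    {td : TailData} (h : tailCheckMI chi K td = true) :
    |frobSol 1 χ 0 - ∑ k ∈ range (K + 1), frobCoeff 1 χ k| ≤ (td.T : ℝ) / S := by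
  obtain ⟨-, hle⟩ := summable_abs_tail_le_T hχ h
  have h0 : (0 : ℝ) ∈ Icc (0 : ℝ) 1 := ⟨le_rfl, zero_le_one⟩
  have h1 := abs_frobSol_sub_sum_le χ h0 (K + 1)
  simp only [sub_zero, one_pow, mul_one] at h1
  exact h1.trans hle

/-- **(R3) `u′(0)` versus the finite weighted sum**: for `χ` in the bracket,
`|frobSol₁ 1 χ 0 + Σ_{k≤K} k·a_k(χ)| ≤ DT·S⁻¹`. [cite: ConnesConsani2021, Prop. 5.3 / Lemma 5.4 §5 pp. 32–33 and §6.3–6.4 p. 24 (in-kernel certificate for the §6 kernel enclosure)] -/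
theorem abs_frobSol₁_zero_add_sum_le_of_tailCheckMI {χ : ℝ} {chi : MI} (hχ : MI.mem S χ chi) {K : ℕ}
    {td : TailData} (h : tailCheckMI chi K td = true) :
    |frobSol₁ 1 χ 0 + ∑ k ∈ range (K + 1), frobCoeff 1 χ k * k| ≤ (td.DT : ℝ) / S := by
  obtain ⟨-, hle⟩ := summable_linear_tail_le_DT hχ h
  have h1 := LFunctions.abs_frobSol₁_zero_add_sum_le χ K
  -- rewrite the finite sum `Σ_{k<K+1} a_k·k = Σ_{k<K} (k+1)·a_{k+1}` and the tail index `k+K+1 = k+(K+1)`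
  have hfin : ∑ k ∈ range (K + 1), frobCoeff 1 χ k * k = ∑ k ∈ range K, ((k : ℝ) + 1) * frobCoeff 1 χ (k + 1) := by
    rw [sum_range_succ']
    simp only [Nat.cast_add, Nat.cast_one, Nat.cast_zero, mul_zero, add_zero]
    refine sum_congr rfl fun k _ ↦ by ring
  have htail : ∑' k : ℕ, (((k + K : ℕ) : ℝ) + 1) * |frobCoeff 1 χ (k + K + 1)|
      = ∑' k : ℕ, ((k + (K + 1) : ℕ) : ℝ) * |frobCoeff 1 χ (k + (K + 1))| := by
    refine tsum_congr fun k ↦ ?_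
    rw [show k + K + 1 = k + (K + 1) from rfl]
    push_cast; ring
  rw [hfin]
  exact h1.trans (le_of_eq htail) |>.trans hle

/-- **Truncation on the whole window `y ∈ [0, 2]`** (i.e. `|1 − y| ≤ 1`, inside the disc of convergence): for `χ` in the bracket,
`|u(y) − Σ_{k≤K} a_k(χ)(1−y)ᵏ| ≤ T·S⁻¹` — the Frobenius polynomial with the kernel's interval coefficients
approximates `frobSol 1 χ` uniformly on `[0, 2] ⊇ [½, 2]`. [cite: CoddingtonLevinson1955, Ch. 4 §8] -/
theorem abs_frobSol_sub_sum_le_of_tailCheckMI {χ : ℝ} {chi : MI} (hχ : MI.mem S χ chi) {K : ℕ}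
    {td : TailData} (h : tailCheckMI chi K td = true) {y : ℝ} (hy' : y ∈ Icc (0 : ℝ) 2) :
    |frobSol 1 χ y - ∑ k ∈ range (K + 1), frobCoeff 1 χ k * (1 - y) ^ k| ≤ (td.T : ℝ) / S := by
  have hy : |1 - y| ≤ 1 := abs_le.2 ⟨by linarith [hy'.2], by linarith [hy'.1]⟩
  have hgeom := geometric_of_tailCheckMI hχ h
  obtain ⟨-, -, -, -, -, -, hT, -⟩ := tailCheckMI_spec h
  have hB : (0 : ℝ) ≤ (td.Bnum : ℝ) / S := by positivity
  obtain ⟨hs, hle⟩ := SlopeCert.tsum_tail_abs_le (y := 1 - y) (by norm_num) (by norm_num) hB hy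
    (K := K) (fun k hk ↦ hgeom k (by omega))
  -- the full series is absolutely summable on `|1 − y| ≤ 1`
  have habs : ∀ k : ℕ, |frobCoeff 1 χ k * (1 - y) ^ k| ≤ |frobCoeff 1 χ k| := fun k ↦ by
    rw [abs_mul, abs_pow]
    exact mul_le_of_le_one_right (abs_nonneg _) (pow_le_one₀ (abs_nonneg _) hy)
  have hsum : Summable fun k : ℕ ↦ frobCoeff 1 χ k * (1 - y) ^ k :=
    Summable.of_norm_bounded (summable_abs_frobCoeff_one χ) fun k ↦ by rw [Real.norm_eq_abs]; exact habs k
  rw [frobSol, ← hsum.sum_add_tsum_nat_add (K + 1), add_sub_cancel_left]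
  have hsK : Summable fun k : ℕ ↦ |frobCoeff 1 χ (k + (K + 1)) * (1 - y) ^ (k + (K + 1))| :=
    ((summable_nat_add_iff (f := fun k ↦ frobCoeff 1 χ k * (1 - y) ^ k) (K + 1)).mpr hsum).abs
  refine (abs_tsum_le hsK).trans ?_
  have e : ∀ k : ℕ, |frobCoeff 1 χ (k + (K + 1)) * (1 - y) ^ (k + (K + 1))|
      = |frobCoeff 1 χ (k + (K + 1))| * |1 - y| ^ (k + (K + 1)) := fun k ↦ by rw [abs_mul, abs_pow]
  simp only [e]
  exact hle.trans (tail_le_T hT)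

/-- **Truncation of the derivative on the window `y ∈ [0, 2]`**: for `χ` in the bracket,
`|u′(y) + Σ_{k<K} (k+1)a_{k+1}(χ)(1−y)ᵏ| ≤ DT·S⁻¹` (`u′ = frobSol₁ 1 χ = −Σ (k+1)a_{k+1}(1−y)ᵏ`).
[cite: CoddingtonLevinson1955, Ch. 4 §8] -/
theorem abs_frobSol₁_add_sum_le_of_tailCheckMI {χ : ℝ} {chi : MI} (hχ : MI.mem S χ chi) {K : ℕ}
    {td : TailData} (h : tailCheckMI chi K td = true) {y : ℝ} (hy' : y ∈ Icc (0 : ℝ) 2) :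
    |frobSol₁ 1 χ y + ∑ k ∈ range K, ((k : ℝ) + 1) * frobCoeff 1 χ (k + 1) * (1 - y) ^ k|
      ≤ (td.DT : ℝ) / S := by
  have hy : |1 - y| ≤ 1 := abs_le.2 ⟨by linarith [hy'.2], by linarith [hy'.1]⟩
  obtain ⟨hs, hle⟩ := summable_linear_tail_le_DT hχ h
  -- the derivative series `g k = (k+1) a_{k+1} (1-y)^k` is dominated by `(k+1)|a_{k+1}|`
  set g : ℕ → ℝ := fun k ↦ ((k : ℝ) + 1) * frobCoeff 1 χ (k + 1) * (1 - y) ^ k with hg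
  have hdom : ∀ k : ℕ, |g k| ≤ ((k : ℝ) + 1) * |frobCoeff 1 χ (k + 1)| := fun k ↦ by
    rw [hg, abs_mul, abs_mul, abs_pow, abs_of_nonneg (by positivity : (0 : ℝ) ≤ (k : ℝ) + 1)]
    exact mul_le_of_le_one_right (by positivity) (pow_le_one₀ (abs_nonneg _) hy)
  have hmaj : Summable fun k : ℕ ↦ ((k : ℝ) + 1) * |frobCoeff 1 χ (k + 1)| := by
    have := summable_succ_mul_abs_frobCoeff_one χ
    simpa using this
  have hsum : Summable g := Summable.of_norm_bounded hmaj fun k ↦ by rw [Real.norm_eq_abs]; exact hdom k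
  have hsol : frobSol₁ 1 χ y = -∑' k : ℕ, g k := by simp only [frobSol₁, hg]
  rw [hsol, ← hsum.sum_add_tsum_nat_add K]
  have e : -(∑ k ∈ range K, g k + ∑' k : ℕ, g (k + K)) + ∑ k ∈ range K, g k = -∑' k : ℕ, g (k + K) := by ring
  rw [show (∑ k ∈ range K, ((k : ℝ) + 1) * frobCoeff 1 χ (k + 1) * (1 - y) ^ k) = ∑ k ∈ range K, g k from rfl,
    e, abs_neg]
  have hsK : Summable fun k : ℕ ↦ |g (k + K)| := ((summable_nat_add_iff K).mpr hsum).abs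
  refine (abs_tsum_le hsK).trans ?_
  have hdomK : ∀ k : ℕ, |g (k + K)| ≤ ((k + (K + 1) : ℕ) : ℝ) * |frobCoeff 1 χ (k + (K + 1))| := fun k ↦ by
    have := hdom (k + K)
    rw [show k + K + 1 = k + (K + 1) from rfl] at this
    push_cast at this ⊢
    linarith
  exact (hsK.tsum_le_tsum hdomK hs).trans hle

/-- The sign test made REAL: if the thin-end sign test passes with `pos = true` and the tail check passes at the
thin bracket `⟨c, c⟩`, then `−u′(0; c·S⁻¹) > 0`, i.e. `frobSol₁ 1 (c/S) 0 < 0`. [cite: ConnesConsani2021, Prop. 5.3 / Lemma 5.4 §5 pp. 32–33 and §6.3–6.4 p. 24 (in-kernel certificate for the §6 kernel enclosure)] -/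
theorem frobSol₁_zero_neg_of_checks {c : ℤ} {K : ℕ} {td : TailData} (ht : tailCheckMI ⟨c, c⟩ K td = true)
    (hs : signNegDerivAt c K td.DT true = true) : frobSol₁ 1 ((c : ℝ) / S) 0 < 0 := by
  have hR3 := abs_frobSol₁_zero_add_sum_le_of_tailCheckMI (MI.mem_ofScaled S_pos c) ht
  have hw : |(-frobSol₁ 1 ((c : ℝ) / S) 0) - ∑ k ∈ range (K + 1), frobCoeff 1 ((c : ℝ) / S) k * k| * S
      ≤ td.DT := by
    have e : (-frobSol₁ 1 ((c : ℝ) / S) 0) - ∑ k ∈ range (K + 1), frobCoeff 1 ((c : ℝ) / S) k * k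
        = -(frobSol₁ 1 ((c : ℝ) / S) 0 + ∑ k ∈ range (K + 1), frobCoeff 1 ((c : ℝ) / S) k * k) := by ring
    rw [e, abs_neg]
    exact (le_div_iff₀ (show (0 : ℝ) < (S : ℝ) by exact_mod_cast S_pos)).1 hR3
  have := pos_of_signNegDerivAt hs hw
  linarith

/-- The sign test made REAL, negative case: `frobSol₁ 1 (c/S) 0 > 0`. [cite: ConnesConsani2021, Prop. 5.3 / Lemma 5.4 §5 pp. 32–33 and §6.3–6.4 p. 24 (in-kernel certificate for the §6 kernel enclosure)] -/
theorem frobSol₁_zero_pos_of_checks {c : ℤ} {K : ℕ} {td : TailData} (ht : tailCheckMI ⟨c, c⟩ K td = true)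
    (hs : signNegDerivAt c K td.DT false = true) : 0 < frobSol₁ 1 ((c : ℝ) / S) 0 := by
  have hR3 := abs_frobSol₁_zero_add_sum_le_of_tailCheckMI (MI.mem_ofScaled S_pos c) ht
  have hw : |(-frobSol₁ 1 ((c : ℝ) / S) 0) - ∑ k ∈ range (K + 1), frobCoeff 1 ((c : ℝ) / S) k * k| * S
      ≤ td.DT := by
    have e : (-frobSol₁ 1 ((c : ℝ) / S) 0) - ∑ k ∈ range (K + 1), frobCoeff 1 ((c : ℝ) / S) k * k
        = -(frobSol₁ 1 ((c : ℝ) / S) 0 + ∑ k ∈ range (K + 1), frobCoeff 1 ((c : ℝ) / S) k * k) := by ring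
    rw [e, abs_neg]
    exact (le_div_iff₀ (show (0 : ℝ) < (S : ℝ) by exact_mod_cast S_pos)).1 hR3
  have := neg_of_signNegDerivAt hs hw
  linarith

/-- Unpacking `modeTailOK`: the whole-bracket and the two thin-end tail checks. [cite: ConnesConsani2021, Prop. 5.3 / Lemma 5.4 §5 pp. 32–33 and §6.3–6.4 p. 24 (in-kernel certificate for the §6 kernel enclosure)] -/
theorem modeTailOK_spec {d : ModeData} (h : modeTailOK d = true) :
    tailCheckMI d.chi d.K d.tail = true ∧ tailCheckMI ⟨d.chiLo, d.chiLo⟩ d.K d.tail = true ∧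
      tailCheckMI ⟨d.chiHi, d.chiHi⟩ d.K d.tail = true := by
  simp only [modeTailOK, Bool.and_eq_true] at h
  exact ⟨h.1.1, h.1.2, h.2⟩

/-- **End signs made real.**  For a mode whose bracket test and thin-end tail checks pass:
if `sLo` then `u′(0; χ⁻) > 0` and `u′(0; χ⁺) < 0`, else the reverse (`u′ = frobSol₁ 1 χ`, `χ± = chi±·S⁻¹`).
[cite: ConnesConsani2021, Prop. 5.3 / Lemma 5.4 §5 pp. 32–33 and §6.3–6.4 p. 24 (in-kernel certificate for the §6 kernel enclosure)] -/
theorem endSigns_of_checks {d : ModeData}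
    (hlo : tailCheckMI ⟨d.chiLo, d.chiLo⟩ d.K d.tail = true)
    (hhi : tailCheckMI ⟨d.chiHi, d.chiHi⟩ d.K d.tail = true) (hb : bracketOK d = true) :
    (d.sLo = true → 0 < frobSol₁ 1 ((d.chiLo : ℝ) / S) 0 ∧ frobSol₁ 1 ((d.chiHi : ℝ) / S) 0 < 0) ∧
    (d.sLo = false → frobSol₁ 1 ((d.chiLo : ℝ) / S) 0 < 0 ∧ 0 < frobSol₁ 1 ((d.chiHi : ℝ) / S) 0) := by
  simp only [bracketOK, Bool.and_eq_true] at hb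
  obtain ⟨h1, h2⟩ := hb
  constructor
  · intro hs
    rw [hs] at h1 h2
    exact ⟨frobSol₁_zero_pos_of_checks hlo h1, frobSol₁_zero_neg_of_checks hhi h2⟩
  · intro hs
    rw [hs] at h1 h2
    exact ⟨frobSol₁_zero_neg_of_checks hlo h1, frobSol₁_zero_pos_of_checks hhi h2⟩

/-- **Whole-bracket real facts.**  For a mode whose whole-bracket tail check passes and every real `χ`
in the bracket: (R1) `|a_k(χ)| ≤ Bnum·S⁻¹·(13/20)ᵏ` for `k ≥ K`; (R2) `|u(0) − Σ_{k≤K} a_k| ≤ T·S⁻¹`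
with `Σ_{k≤K} a_k ∈ u0MI`; (R3) `|u′(0) + Σ_{k≤K} k a_k| ≤ DT·S⁻¹`; and the finite sums
`Σ a_k/(k+1) ∈ iMI`, `ΣΣ a_i a_j/(i+j+1) ∈ dMI`. [cite: ConnesConsani2021, Prop. 5.3 / Lemma 5.4 §5 pp. 32–33 and §6.3–6.4 p. 24 (in-kernel certificate for the §6 kernel enclosure)] -/
theorem bracketFacts_of_checks {d : ModeData} (h : tailCheckMI d.chi d.K d.tail = true)
    {χ : ℝ} (hχ : MI.mem S χ d.chi) :
    (∀ k, d.K ≤ k → |frobCoeff 1 χ k| ≤ (d.tail.Bnum : ℝ) / S * (13 / 20) ^ k) ∧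
    |frobSol 1 χ 0 - ∑ k ∈ range (d.K + 1), frobCoeff 1 χ k| ≤ (d.tail.T : ℝ) / S ∧
    MI.mem S (∑ k ∈ range (d.K + 1), frobCoeff 1 χ k) (u0MI d.chi (d.K + 1)) ∧
    |frobSol₁ 1 χ 0 + ∑ k ∈ range (d.K + 1), frobCoeff 1 χ k * k| ≤ (d.tail.DT : ℝ) / S ∧
    MI.mem S (∑ k ∈ range (d.K + 1), frobCoeff 1 χ k / (k + 1)) (iMI d.chi (d.K + 1)) ∧
    MI.mem S (∑ i ∈ range (d.K + 1), ∑ j ∈ range (d.K + 1), frobCoeff 1 χ i * frobCoeff 1 χ j / (i + j + 1))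
      (dMI d.chi (d.K + 1)) :=
  ⟨geometric_of_tailCheckMI hχ h, abs_frobSol_zero_sub_sum_le_of_tailCheckMI hχ h, mem_u0MI hχ _,
    abs_frobSol₁_zero_add_sum_le_of_tailCheckMI hχ h, mem_iMI hχ _, mem_dMI hχ _⟩

/-- The scaled bound `sAbs` of `modeEncl` dominates `Σ_{k<n} |a_k|`: for `χ` in the bracket,
`(Σ_{k<n} |a_k(χ)|)·S ≤ (sumMI (fun k ↦ ⟨−|A_k|, |A_k|⟩) n).hi`. [cite: ConnesConsani2021, Prop. 5.3 / Lemma 5.4 §5 pp. 32–33 and §6.3–6.4 p. 24 (in-kernel certificate for the §6 kernel enclosure)] -/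
theorem sum_abs_mul_S_le_sAbs {χ : ℝ} {chi : MI} (hχ : MI.mem S χ chi) (n : ℕ) :
    (∑ k ∈ range n, |frobCoeff 1 χ k|) * S
      ≤ ((sumMI (fun k ↦ let A := frobCoeffMI chi k; ⟨-A.absHi, A.absHi⟩) n).hi : ℝ) := by
  induction n with
  | zero => simp [sumMI, MI.ofInt]
  | succ n ih =>
    rw [sum_range_succ, add_mul]
    have hk := MI.abs_le_absHi (mem_frobCoeffMI hχ n)
    simp only [sumMI, MI.add, Int.cast_add]
    exact add_le_add ih hk

/-! ## Part C — the per-mode package: IVT, the enclosures of `u(0), ∫₀¹u, ∫₀¹u²`, and the quotients -/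

/-- `x ∈ [lo·S⁻¹, hi·S⁻¹] ⇒ x ∈ ⟨lo, hi⟩`. [cite: ConnesConsani2021, Prop. 5.3 / Lemma 5.4 §5 pp. 32–33 and §6.3–6.4 p. 24 (in-kernel certificate for the §6 kernel enclosure)] -/
theorem mem_of_Icc {x : ℝ} {lo hi : ℤ} (h : x ∈ Icc ((lo : ℝ) / S) ((hi : ℝ) / S)) :
    MI.mem S x ⟨lo, hi⟩ := by
  have hS : (0 : ℝ) < (S : ℝ) := by exact_mod_cast S_pos
  refine ⟨?_, ?_⟩
  · have := h.1; rwa [div_le_iff₀ hS] at this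
  · have := h.2; rwa [le_div_iff₀ hS] at this

/-- Members of `I` lie in `[I.lo·S⁻¹, I.hi·S⁻¹]`. [cite: ConnesConsani2021, Prop. 5.3 / Lemma 5.4 §5 pp. 32–33 and §6.3–6.4 p. 24 (in-kernel certificate for the §6 kernel enclosure)] -/
theorem Icc_of_mem {x : ℝ} {I : MI} (h : MI.mem S x I) : x ∈ Icc ((I.lo : ℝ) / S) ((I.hi : ℝ) / S) :=
  ⟨MI.lo_div_le S_pos h, MI.le_hi_div S_pos h⟩

/-- Integer floor division against reals: `n/m ≤ ⌊n/m⌋ + 1` (`m > 0`). [folklore] -/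
private theorem int_div_real_le_ediv_add_one (n : ℤ) {m : ℤ} (hm : 0 < m) :
    (n : ℝ) / m ≤ ((n / m : ℤ) : ℝ) + 1 := by
  have h1 : n % m < m := Int.emod_lt_of_pos n hm
  have h3 : n % m + m * (n / m) = n := Int.emod_add_mul_ediv n m
  have hmr : (0 : ℝ) < m := by exact_mod_cast hm
  rw [div_le_iff₀ hmr]
  have h3r : ((n % m : ℤ) : ℝ) + (m : ℝ) * ((n / m : ℤ) : ℝ) = n := by exact_mod_cast h3
  have h1r : ((n % m : ℤ) : ℝ) < m := by exact_mod_cast h1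
  nlinarith

/-- **IVT on the bracket.**  For a mode whose three tail checks and bracket sign test pass (and `chiLo ≤ chiHi`)
there is a critical Frobenius parameter `b` in the bracket: `u_b′(0) = 0`, so that the even extension of `u_b` is
a Dirichlet eigenfunction of the prolate operator `W_λ`, `λ = 1`, i.e. a member of the prolate family.
[cite: ConnesConsani2021, Prop. 5.3 / Lemma 5.4 §5 pp. 32–33 and §6.3–6.4 p. 24 (in-kernel certificate for the §6 kernel enclosure); SlepianPollak1961, §III] -/
theorem exists_critical_of_checks {d : ModeData} (hok : modeTailOK d = true) (hb : bracketOK d = true)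
    (hle : d.chiLo ≤ d.chiHi) :
    ∃ b ∈ Icc ((d.chiLo : ℝ) / S) ((d.chiHi : ℝ) / S), frobSol₁ 1 b 0 = 0 := by
  obtain ⟨-, hTlo, hThi⟩ := modeTailOK_spec hok
  have hle' : (d.chiLo : ℝ) / S ≤ (d.chiHi : ℝ) / S :=
    div_le_div_of_nonneg_right (by exact_mod_cast hle) (show (0 : ℝ) < (S : ℝ) by exact_mod_cast S_pos).le
  have hsigns := endSigns_of_checks hTlo hThi hb
  cases hs : d.sLo
  · obtain ⟨h1, h2⟩ := hsigns.2 hs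
    exact exists_critical_of_sign_change hle' h1.le h2.le
  · obtain ⟨h1, h2⟩ := hsigns.1 hs
    exact exists_critical_of_sign_change' hle' h1.le h2.le

/-- **The three enclosures of `modeEncl` are sound**: for a mode whose whole-bracket tail check passes and every
real `χ` in the bracket, `u(0) = frobSol 1 χ 0 ∈ U`, `∫₀¹ u ∈ I₁`, `∫₀¹ u² ∈ I₂` (`(U, I₁, I₂) = modeEncl d`; the
series links `∫₀¹u = Σ a_k/(k+1)`, `∫₀¹u² = ΣΣ a_i a_j/(i+j+1)` are `EpsSlopeFrobeniusSeries`). [cite: ConnesConsani2021, Prop. 5.3 / Lemma 5.4 §5 pp. 32–33 and §6.3–6.4 p. 24 (in-kernel certificate for the §6 kernel enclosure)] -/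
theorem mem_modeEncl {d : ModeData} (hT : tailCheckMI d.chi d.K d.tail = true) {χ : ℝ}
    (hχ : MI.mem S χ d.chi) :
    MI.mem S (frobSol 1 χ 0) (modeEncl d).1 ∧
    MI.mem S (∫ x in (0 : ℝ)..1, frobSol 1 χ x) (modeEncl d).2.1 ∧
    MI.mem S (∫ x in (0 : ℝ)..1, frobSol 1 χ x ^ 2) (modeEncl d).2.2 := by
  have hS : (0 : ℝ) < (S : ℝ) := by exact_mod_cast S_pos
  obtain ⟨-, hR2, hmemU0, -, hmemI, hmemD⟩ := bracketFacts_of_checks hT hχ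
  obtain ⟨-, hτ⟩ := summable_abs_tail_le_T hχ hT
  set τ : ℝ := ∑' j : ℕ, |frobCoeff 1 χ (j + (d.K + 1))| with hτdef
  have hτ0 : 0 ≤ τ := tsum_nonneg fun _ ↦ abs_nonneg _
  refine ⟨?_, ?_, ?_⟩
  · simp only [modeEncl]
    refine MI.mem_widen hmemU0 ?_
    rw [← le_div_iff₀ hS]; exact hR2
  · simp only [modeEncl]
    refine MI.mem_widen hmemI ?_
    rw [← le_div_iff₀ hS]
    exact (SlopeCert.abs_integral_frobSol_one_sub_le χ (d.K + 1)).trans hτ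
  · simp only [modeEncl]
    refine MI.mem_widen hmemD ?_
    set sAbs : ℤ := (sumMI (fun k ↦ let A := frobCoeffMI d.chi k; ⟨-A.absHi, A.absHi⟩) (d.K + 1)).hi
    set A : ℝ := ∑ j ∈ range (d.K + 1), |frobCoeff 1 χ j| with hAdef
    have hA0 : 0 ≤ A := Finset.sum_nonneg fun _ _ ↦ abs_nonneg _
    have hAs : A * S ≤ (sAbs : ℝ) := sum_abs_mul_S_le_sAbs hχ (d.K + 1)
    have h1 := SlopeCert.abs_integral_frobSol_sq_one_sub_le χ (d.K + 1)
    have hT0 : (0 : ℝ) ≤ d.tail.T := by positivity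
    -- |I₂ − ΣΣ|·S ≤ (2 A τ + τ²)·S ≤ (2·sAbs·T + T²)/S ≤ ⌊(2 sAbs T + T T)/S⌋ + 1
    have h2 : (2 * A * τ + τ ^ 2) * S
        ≤ (2 * (sAbs : ℝ) * (d.tail.T : ℝ) + (d.tail.T : ℝ) * (d.tail.T : ℝ)) / S := by
      rw [le_div_iff₀ hS]
      have hτ' : τ * S ≤ d.tail.T := by rw [← le_div_iff₀ hS]; exact hτ
      have hAτ : A * S * (τ * S) ≤ sAbs * d.tail.T := mul_le_mul hAs hτ' (by positivity) (by
        have : (0 : ℝ) ≤ A * S := by positivity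
        linarith)
      have hττ : τ * S * (τ * S) ≤ d.tail.T * d.tail.T := mul_le_mul hτ' hτ' (by positivity) hT0
      nlinarith
    have h3 := int_div_real_le_ediv_add_one (2 * sAbs * d.tail.T + d.tail.T * d.tail.T) (show (0 : ℤ) < (S : ℤ) by exact_mod_cast S_pos)
    push_cast at h3 ⊢
    calc |(∫ x in (0 : ℝ)..1, frobSol 1 χ x ^ 2) - ∑ i ∈ range (d.K + 1), ∑ j ∈ range (d.K + 1),
            frobCoeff 1 χ i * frobCoeff 1 χ j / ((i : ℝ) + j + 1)| * S
        ≤ (2 * A * τ + τ ^ 2) * S := by gcongr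
      _ ≤ _ := h2.trans h3

/-- **The four quotient intervals of `modeQuantities` are sound**: if `modeQuantities d = some q` and the reals
`u₀, I₁, I₂` lie in the three intervals of `modeEncl d`, then `L² := (2I₁/u₀)² ∈ q.1`, `P := 1/(2I₂) ∈ q.2.1`,
`L²·P ∈ q.2.2.1` and `2L²/(1−L²)·P ∈ q.2.2.2`. [cite: ConnesConsani2021, Prop. 5.3 / Lemma 5.4 §5 pp. 32–33 and §6.3–6.4 p. 24 (in-kernel certificate for the §6 kernel enclosure)] -/
theorem mem_modeQuantities {d : ModeData} {q : MI × MI × MI × MI} (hq : modeQuantities d = some q)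
    {u0 I1 I2 : ℝ} (hU : MI.mem S u0 (modeEncl d).1) (hI1m : MI.mem S I1 (modeEncl d).2.1)
    (hI2m : MI.mem S I2 (modeEncl d).2.2) :
    MI.mem S ((2 * I1 / u0) ^ 2) q.1 ∧ MI.mem S (1 / (2 * I2)) q.2.1 ∧
    MI.mem S ((2 * I1 / u0) ^ 2 * (1 / (2 * I2))) q.2.2.1 ∧
    MI.mem S (2 * (2 * I1 / u0) ^ 2 / (1 - (2 * I1 / u0) ^ 2) * (1 / (2 * I2))) q.2.2.2 := by
  simp only [modeQuantities] at hq
  set E := modeEncl d with hE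
  -- the eigenvalue quotient
  obtain ⟨lam, hlamEq, hlamMem⟩ : ∃ lam : MI,
      (if 0 < E.1.lo then (E.2.1.mulInt 2).divPos S E.1
        else if E.1.hi < 0 then (E.2.1.mulInt (-2)).divPos S E.1.neg else none) = some lam ∧
      MI.mem S (2 * I1 / u0) lam := by
    by_cases h1 : 0 < E.1.lo
    · rw [if_pos h1] at hq ⊢
      cases hdp : MI.divPos S (E.2.1.mulInt 2) E.1 with
      | none => rw [hdp] at hq; simp at hq
      | some lam =>
        refine ⟨lam, rfl, ?_⟩
        have := MI.mem_divPos S_pos hdp (MI.mem_mulInt hI1m 2) hU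
        push_cast at this
        rwa [mul_comm] at this
    · rw [if_neg h1] at hq ⊢
      by_cases h2 : E.1.hi < 0
      · rw [if_pos h2] at hq ⊢
        cases hdp : MI.divPos S (E.2.1.mulInt (-2)) E.1.neg with
        | none => rw [hdp] at hq; simp at hq
        | some lam =>
          refine ⟨lam, rfl, ?_⟩
          have := MI.mem_divPos S_pos hdp (MI.mem_mulInt hI1m (-2)) (MI.mem_neg hU)
          push_cast at this
          have e : I1 * -2 / -u0 = 2 * I1 / u0 := by
            rw [show I1 * -2 = -(2 * I1) by ring, neg_div_neg_eq]
          rwa [e] at this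
      · rw [if_neg h2] at hq
        simp at hq
  rw [hlamEq] at hq
  simp only at hq
  cases hp : MI.divPos S (MI.ofInt S 1) (E.2.2.mulInt 2) with
  | none => rw [hp] at hq; simp at hq
  | some p1 =>
    rw [hp] at hq
    simp only at hq
    have hPmem : MI.mem S (1 / (2 * I2)) p1 := by
      have := MI.mem_divPos S_pos hp (MI.mem_ofInt S 1) (MI.mem_mulInt hI2m 2)
      push_cast at this
      rwa [mul_comm I2 2] at this
    have hL2mem : MI.mem S ((2 * I1 / u0) ^ 2) (lam.sqr S) := MI.mem_sqr S_pos hlamMem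
    cases ht : MI.divPos S (((lam.sqr S).mulInt 2).mul S p1) ((MI.ofInt S 1).sub (lam.sqr S)) with
    | none => rw [ht] at hq; simp at hq
    | some t =>
      rw [ht] at hq
      simp only [Option.some.injEq] at hq
      subst hq
      have htmem : MI.mem S (2 * (2 * I1 / u0) ^ 2 / (1 - (2 * I1 / u0) ^ 2) * (1 / (2 * I2))) t := by
        have := MI.mem_divPos S_pos ht (MI.mem_mul S_pos (MI.mem_mulInt hL2mem 2) hPmem)
          (MI.mem_sub (MI.mem_ofInt S 1) hL2mem)
        push_cast at this
        have e : (2 * I1 / u0) ^ 2 * 2 * (1 / (2 * I2)) / (1 - (2 * I1 / u0) ^ 2) =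
            2 * (2 * I1 / u0) ^ 2 / (1 - (2 * I1 / u0) ^ 2) * (1 / (2 * I2)) := by ring
        rwa [e] at this
      exact ⟨hL2mem, hPmem, MI.mem_mul S_pos hL2mem hPmem, htmem⟩

/-- **The prolate data of a critical parameter, enclosed.**  For a mode whose whole-bracket tail check passes
and whose quotient intervals exist, and ANY critical `b` in the bracket with zero count `k` (so that the even
extension of `u_b` is `± prolateFun k / C`): the tree's `λ(k)² = prolateEigen k ^ 2`,
`ψ_k(1)² = prolateFun k 1 ^ 2 = 1/(2∫₀¹u_b²)`, their product and `t(k) = epsSlopeTerm (prolateFun k)` lie in the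
four intervals of `q` (read off `u_b` by `prolateEigen_eq_of_frobSol`, `prolateFun_one_sq_eq_of_frobSol`,
`epsSlopeTerm_prolateFun_eq_of_frobSol`). [cite: ConnesConsani2021, Prop. 5.3 / Lemma 5.4 §5 pp. 32–33 and §6.3–6.4 p. 24 (in-kernel certificate for the §6 kernel enclosure)] -/
theorem mem_modeQuantities_of_critical {d : ModeData} (hT : tailCheckMI d.chi d.K d.tail = true)
    {q : MI × MI × MI × MI} (hq : modeQuantities d = some q) {b : ℝ}
    (hbI : b ∈ Icc ((d.chiLo : ℝ) / S) ((d.chiHi : ℝ) / S)) (hB : frobSol₁ 1 b 0 = 0) {k : ℕ}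
    (hk : {x | x ∈ Ioo (0 : ℝ) 1 ∧ frobSol 1 b x = 0}.ncard = k) :
    MI.mem S (prolateEigen k ^ 2) q.1 ∧ MI.mem S (prolateFun k 1 ^ 2) q.2.1 ∧
      MI.mem S (prolateEigen k ^ 2 * prolateFun k 1 ^ 2) q.2.2.1 ∧
      MI.mem S (epsSlopeTerm (prolateFun k)) q.2.2.2 := by
  have hχ : MI.mem S b d.chi := mem_of_Icc hbI
  obtain ⟨hU, hI1, hI2⟩ := mem_modeEncl hT hχ
  have h := mem_modeQuantities hq hU hI1 hI2
  rw [prolateEigen_eq_of_frobSol hB hk, prolateFun_one_sq_eq_of_frobSol hB hk,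
    epsSlopeTerm_prolateFun_eq_of_frobSol hB hk]
  exact h

/-- **The per-mode package** (the `MI` twin of `SlopeCert.mode_package`): for a mode whose bracket test passes,
whose three tail checks pass (`modeTailOK`), with `chiLo ≤ chiHi`, and whose quotient intervals exist
(`modeQuantities d = some q`), there are a critical parameter `b` in the bracket and its zero count `k`, and the
tree's `λ(k)², ψ_k(1)², λ(k)²ψ_k(1)², t(k) = epsSlopeTerm (prolateFun k)` lie in the four intervals of `q`.
[cite: ConnesConsani2021, Prop. 5.3 / Lemma 5.4 §5 pp. 32–33 and §6.3–6.4 p. 24 (in-kernel certificate for the §6 kernel enclosure)] -/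
theorem mode_package {d : ModeData} (hok : modeTailOK d = true) (hb : bracketOK d = true)
    (hle : d.chiLo ≤ d.chiHi) {q : MI × MI × MI × MI} (hq : modeQuantities d = some q) :
    ∃ (b : ℝ) (k : ℕ), frobSol₁ 1 b 0 = 0 ∧ (d.chiLo : ℝ) / S ≤ b ∧ b ≤ (d.chiHi : ℝ) / S ∧
      {x | x ∈ Ioo (0 : ℝ) 1 ∧ frobSol 1 b x = 0}.ncard = k ∧
      MI.mem S (prolateEigen k ^ 2) q.1 ∧ MI.mem S (prolateFun k 1 ^ 2) q.2.1 ∧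
      MI.mem S (prolateEigen k ^ 2 * prolateFun k 1 ^ 2) q.2.2.1 ∧
      MI.mem S (epsSlopeTerm (prolateFun k)) q.2.2.2 := by
  obtain ⟨hT, -, -⟩ := modeTailOK_spec hok
  obtain ⟨b, hbI, hB⟩ := exists_critical_of_checks hok hb hle
  refine ⟨b, _, hB, hbI.1, hbI.2, rfl, ?_⟩
  exact mem_modeQuantities_of_critical hT hq hbI hB rfl

/-! ## Part D — decoding the kernel verdict `modesCheck_eq_true`, per mode of record -/

/-- Every mode of record passes its bracket sign test and its three tail checks (read off `modesCheck_eq_true`).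
[cite: ConnesConsani2021, Prop. 5.3 / Lemma 5.4 §5 pp. 32–33 and §6.3–6.4 p. 24 (in-kernel certificate for the §6 kernel enclosure)] -/
theorem checks_of_mem_modes {d : ModeData} (hd : d ∈ modes) : bracketOK d = true ∧ modeTailOK d = true := by
  have h := modesCheck_eq_true
  rw [modesCheck, Bool.and_eq_true, Bool.and_eq_true, Bool.and_eq_true] at h
  obtain ⟨⟨⟨hb, ht⟩, -⟩, -⟩ := h
  rw [bracketsOK, List.all_eq_true] at hb
  rw [tailsOK, List.all_eq_true] at ht
  exact ⟨hb d hd, ht d hd⟩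

/-- Every bracket of record is a genuine interval: `chiLo ≤ chiHi`. [cite: ConnesConsani2021, Prop. 5.3 / Lemma 5.4 §5 pp. 32–33 and §6.3–6.4 p. 24 (in-kernel certificate for the §6 kernel enclosure)] -/
theorem chiLo_le_chiHi_of_mem_modes {d : ModeData} (hd : d ∈ modes) : d.chiLo ≤ d.chiHi := by
  have h : ∀ d ∈ modes, d.chiLo ≤ d.chiHi := by decide
  exact h d hd

/-- **A critical parameter for every mode of record**: for every `d ∈ modes` there is `b` in its bracket with
`u_b′(0) = 0` (the even extension of `u_b` is then a member of the prolate family, `λ = 1`).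
[cite: ConnesConsani2021, Prop. 5.3 / Lemma 5.4 §5 pp. 32–33 and §6.3–6.4 p. 24 (in-kernel certificate for the §6 kernel enclosure); SlepianPollak1961, §III] -/
theorem exists_critical_of_mem_modes {d : ModeData} (hd : d ∈ modes) :
    ∃ b ∈ Icc ((d.chiLo : ℝ) / S) ((d.chiHi : ℝ) / S), frobSol₁ 1 b 0 = 0 := by
  obtain ⟨hb, hok⟩ := checks_of_mem_modes hd
  exact exists_critical_of_checks hok hb (chiLo_le_chiHi_of_mem_modes hd)

/-- **The package of a mode of record**, given its quotient package `q` (whose existence for every `d ∈ modes`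
follows from `slopeFineCheck`, decoded together with `totals` by the consumer): a critical `b` in the bracket, its
zero count `k`, and `λ(k)², ψ_k(1)², λ(k)²ψ_k(1)², t(k)` in the four intervals of `q`.
[cite: ConnesConsani2021, Prop. 5.3 / Lemma 5.4 §5 pp. 32–33 and §6.3–6.4 p. 24 (in-kernel certificate for the §6 kernel enclosure)] -/
theorem mode_package_of_mem_modes {d : ModeData} (hd : d ∈ modes) {q : MI × MI × MI × MI}
    (hq : modeQuantities d = some q) :
    ∃ (b : ℝ) (k : ℕ), frobSol₁ 1 b 0 = 0 ∧ (d.chiLo : ℝ) / S ≤ b ∧ b ≤ (d.chiHi : ℝ) / S ∧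
      {x | x ∈ Ioo (0 : ℝ) 1 ∧ frobSol 1 b x = 0}.ncard = k ∧
      MI.mem S (prolateEigen k ^ 2) q.1 ∧ MI.mem S (prolateFun k 1 ^ 2) q.2.1 ∧
      MI.mem S (prolateEigen k ^ 2 * prolateFun k 1 ^ 2) q.2.2.1 ∧
      MI.mem S (epsSlopeTerm (prolateFun k)) q.2.2.2 := by
  obtain ⟨hb, hok⟩ := checks_of_mem_modes hd
  exact mode_package hok hb (chiLo_le_chiHi_of_mem_modes hd) hq

/-! ## Part D-2 — decoding `totals` and the SLOPE-FINE inequalities (ONE kernel evaluation of the eight modes)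

Kernel-cost note (measured on the farm, 2026-08-26): a declaration whose proof makes the kernel compare
`slopeFineCheck` with its unfolded body costs ≈ 45 s (the matcher is unfolded first and `Option.rec` on the closed
term `totals` forces the evaluation of all eight modes), so this section unfolds it in exactly ONE declaration,
`slopeFine_decoded`, and derives everything else from that statement. -/

/-- `slopeFineCheck` passed (read off `modesCheck_eq_true`; cheap). [cite: ConnesConsani2021, Prop. 5.3 / Lemma 5.4 §5 pp. 32–33 and §6.3–6.4 p. 24 (in-kernel certificate for the §6 kernel enclosure)] -/
theorem slopeFineCheck_eq_true : slopeFineCheck = true := by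
  have h := modesCheck_eq_true
  rw [modesCheck, Bool.and_eq_true] at h
  exact h.2

/-- `chainOK` passed (read off `modesCheck_eq_true`; cheap). [cite: ConnesConsani2021, Prop. 5.3 / Lemma 5.4 §5 pp. 32–33 and §6.3–6.4 p. 24 (in-kernel certificate for the §6 kernel enclosure)] -/
theorem chainOK_eq_true : chainOK = true := by
  have h := modesCheck_eq_true
  rw [modesCheck, Bool.and_eq_true, Bool.and_eq_true] at h
  exact h.1.2

/-- **SLOPE-FINE decoded** (the one declaration that unfolds `slopeFineCheck`): `totals = some R` and the four
scaled-integer inequalities of `slopeFineCheck` on `R = (Σ t, Σ λ²ψ(1)², Σ λ²)`: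
`eLoNum ≤ (Σt).lo`, `4·(⌊2978·S/1000⌋ + 1 − (Σλ²).lo) ≤ 3·S`, `0 ≤ S − (Σλ²ψ²).lo`,
`(Σt).hi + 8·(S − (Σλ²ψ²).lo) ≤ eHiNum`. [cite: ConnesConsani2021, Prop. 5.3 / Lemma 5.4 §5 pp. 32–33 and §6.3–6.4 p. 24 (in-kernel certificate for the §6 kernel enclosure)] -/
theorem slopeFine_decoded : ∃ R : MI × MI × MI, totals = some R ∧ eLoNum ≤ R.1.lo ∧
    4 * ((2978 * (S : ℤ)) / 1000 + 1 - R.2.2.lo) ≤ 3 * (S : ℤ) ∧ 0 ≤ (S : ℤ) - R.2.1.lo ∧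
    R.1.hi + 8 * ((S : ℤ) - R.2.1.lo) ≤ eHiNum := by
  have hs := slopeFineCheck_eq_true
  revert hs
  unfold slopeFineCheck
  generalize totals = t
  rcases t with _ | ⟨A, B, C⟩
  · intro h; exact absurd h Bool.false_ne_true
  · intro h
    simp only [Bool.and_eq_true, decide_eq_true_eq] at h
    exact ⟨(A, B, C), rfl, h.1.1.1, h.1.1.2, h.1.2, h.2⟩

/-- A fold whose step only succeeds on two `some`s succeeds only if every entry is `some`. [folklore] -/
private theorem isSome_of_foldr_isSome {α β : Type*} {F : Option α → Option β → Option β}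
    (hF : ∀ a b, (F a b).isSome = true → a.isSome = true ∧ b.isSome = true) :
    ∀ (l : List (Option α)) (init : Option β), (l.foldr F init).isSome = true →
      ∀ a ∈ l, a.isSome = true := by
  intro l
  induction l with
  | nil => simp
  | cons x l ih =>
    intro init h a ha
    rw [List.foldr_cons] at h
    obtain ⟨hx, hrest⟩ := hF _ _ h
    rcases List.mem_cons.1 ha with rfl | ha'
    · exact hx
    · exact ih init hrest a ha'

/-- Every mode of record has its quotient package: `modeQuantities d = some q` (from `totals = some R`; cheap).
[cite: ConnesConsani2021, Prop. 5.3 / Lemma 5.4 §5 pp. 32–33 and §6.3–6.4 p. 24 (in-kernel certificate for the §6 kernel enclosure)] -/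
theorem modeQuantities_isSome_of_mem_modes {d : ModeData} (hd : d ∈ modes) :
    ∃ q, modeQuantities d = some q := by
  obtain ⟨R, hR, -⟩ := slopeFine_decoded
  have h : totals.isSome = true := Option.isSome_iff_exists.2 ⟨R, hR⟩
  unfold totals at h
  have key := isSome_of_foldr_isSome (fun a b hab ↦ by
      cases a <;> cases b <;> simp_all) _ _ h (modeQuantities d) (List.mem_map.2 ⟨d, hd, rfl⟩)
  exact Option.isSome_iff_exists.1 key

/-- The modes of record are eight. [cite: ConnesConsani2021, Prop. 5.3 / Lemma 5.4 §5 pp. 32–33 and §6.3–6.4 p. 24 (in-kernel certificate for the §6 kernel enclosure)] -/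
theorem length_modes : modes.length = 8 := rfl

/-- The fold behind `totals`, read back generically (indexed form): per-entry memberships add up. [folklore] -/
private theorem mem_foldr_aux {F : Option (MI × MI × MI × MI) → Option (MI × MI × MI) → Option (MI × MI × MI)}
    (hF : ∀ q acc, F (some q) (some acc) = some (acc.1.add q.2.2.2, acc.2.1.add q.2.2.1, acc.2.2.add q.1))
    (hF' : ∀ a b, (F a b).isSome = true → a.isSome = true ∧ b.isSome = true) :
    ∀ (l : List ModeData) (t p m : ℕ → ℝ), (∀ (j : ℕ) (hj : j < l.length), ∀ q, modeQuantities l[j] = some q →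
        MI.mem S (m j) q.1 ∧ MI.mem S (p j) q.2.2.1 ∧ MI.mem S (t j) q.2.2.2) →
      ∀ R, (l.map modeQuantities).foldr F (some (MI.ofInt S 0, MI.ofInt S 0, MI.ofInt S 0)) = some R →
        MI.mem S (∑ j ∈ range l.length, t j) R.1 ∧ MI.mem S (∑ j ∈ range l.length, p j) R.2.1 ∧
          MI.mem S (∑ j ∈ range l.length, m j) R.2.2 := by
  intro l
  induction l with
  | nil =>
    intro t p m _ R hR
    simp only [List.map_nil, List.foldr_nil, Option.some.injEq] at hR
    subst hR
    have h0 := MI.mem_ofInt S 0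
    simp only [Int.cast_zero] at h0
    simp only [List.length_nil, Finset.range_zero, Finset.sum_empty]
    exact ⟨h0, h0, h0⟩
  | cons d l ih =>
    intro t p m hl R hR
    rw [List.map_cons, List.foldr_cons] at hR
    obtain ⟨hq?, hacc?⟩ := hF' _ _ (by rw [hR]; rfl)
    obtain ⟨q, hq⟩ := Option.isSome_iff_exists.1 hq?
    obtain ⟨acc, hacc⟩ := Option.isSome_iff_exists.1 hacc?
    rw [hq, hacc, hF] at hR
    simp only [Option.some.injEq] at hR
    subst hR
    have h0 := hl 0 (by simp) q (by simpa using hq)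
    obtain ⟨hm, hp, ht⟩ := h0
    have ih' := ih (fun j ↦ t (j + 1)) (fun j ↦ p (j + 1)) (fun j ↦ m (j + 1))
      (fun j hj q' hq' ↦ hl (j + 1) (by simpa using hj) q' (by simpa using hq')) acc hacc
    obtain ⟨iht, ihp, ihm⟩ := ih'
    rw [List.length_cons, Finset.sum_range_succ', Finset.sum_range_succ', Finset.sum_range_succ']
    exact ⟨MI.mem_add iht ht, MI.mem_add ihp hp, MI.mem_add ihm hm⟩

/-- **`totals` read back** (indexed over the modes of record `modes[0..7]`): if for every `j < 8` the reals
`m j, p j, t j` lie in the components `q.1 (λ²), q.2.2.1 (λ²ψ(1)²), q.2.2.2 (t)` of the quotient package of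
`modes[j]`, then `totals = some R` encloses `Σ_{j<8} t j ∈ R.1`, `Σ_{j<8} p j ∈ R.2.1`, `Σ_{j<8} m j ∈ R.2.2`.  Use with
`mem_modeQuantities_of_critical` (`m j = prolateEigen j ^ 2`, `p j = λ_j²ψ_j(1)²`, `t j = epsSlopeTerm (prolateFun j)`
once mode `j` is identified). [cite: ConnesConsani2021, Prop. 5.3 / Lemma 5.4 §5 pp. 32–33 and §6.3–6.4 p. 24 (in-kernel certificate for the §6 kernel enclosure)] -/
theorem mem_totals {t p m : ℕ → ℝ}
    (h : ∀ (j : ℕ) (hj : j < modes.length), ∀ q, modeQuantities modes[j] = some q →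
      MI.mem S (m j) q.1 ∧ MI.mem S (p j) q.2.2.1 ∧ MI.mem S (t j) q.2.2.2)
    {R : MI × MI × MI} (hR : totals = some R) :
    MI.mem S (∑ j ∈ range 8, t j) R.1 ∧ MI.mem S (∑ j ∈ range 8, p j) R.2.1 ∧
      MI.mem S (∑ j ∈ range 8, m j) R.2.2 := by
  unfold totals at hR
  have := mem_foldr_aux (fun _ _ ↦ rfl) (fun a b hab ↦ by cases a <;> cases b <;> simp_all) modes t p m h R hR
  rwa [length_modes] at this

/-- **SLOPE-FINE made real**: with per-mode reals as in `mem_totals`, the kernel verdict gives the six real inputs of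
the index-free tail frame (`EpsSlopeTailFrame`/`EpsSlopeEnclosure` §4 shape): lower sums `Sₗ ≤ Σ_{j<8} p j`
(`λ²ψ(1)²`), `Mₗ ≤ Σ_{j<8} m j` (`λ²`), `Λ = 5/2 + 478/1000 − Mₗ ≤ 3/4`, `0 ≤ 1 − Sₗ`, and the window
`eLoNum·S⁻¹ ≤ Σ_{j<8} t j`, `Σ_{j<8} t j + 8(1 − Sₗ) ≤ eHiNum·S⁻¹`. [cite: ConnesConsani2021, Prop. 5.3 / Lemma 5.4 §5 pp. 32–33 and §6.3–6.4 p. 24 (in-kernel certificate for the §6 kernel enclosure)] -/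
theorem slopeFine_real {t p m : ℕ → ℝ}
    (h : ∀ (j : ℕ) (hj : j < modes.length), ∀ q, modeQuantities modes[j] = some q →
      MI.mem S (m j) q.1 ∧ MI.mem S (p j) q.2.2.1 ∧ MI.mem S (t j) q.2.2.2) :
    ∃ Sl Ml : ℝ, Sl ≤ ∑ j ∈ range 8, p j ∧ Ml ≤ ∑ j ∈ range 8, m j ∧
      5 / 2 + 478 / 1000 - Ml ≤ 3 / 4 ∧ 0 ≤ 1 - Sl ∧
      (eLoNum : ℝ) / S ≤ ∑ j ∈ range 8, t j ∧ ∑ j ∈ range 8, t j + 8 * (1 - Sl) ≤ (eHiNum : ℝ) / S := by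
  obtain ⟨R, hR, h1, h2, h3, h4⟩ := slopeFine_decoded
  obtain ⟨ht, hp, hm⟩ := mem_totals h hR
  have hS : (0 : ℝ) < (S : ℝ) := by exact_mod_cast S_pos
  refine ⟨(R.2.1.lo : ℝ) / S, (R.2.2.lo : ℝ) / S, MI.lo_div_le S_pos hp, MI.lo_div_le S_pos hm, ?_, ?_, ?_, ?_⟩
  · -- 4·(⌊2978 S/1000⌋ + 1 − C.lo) ≤ 3 S and 2978 S/1000 ≤ ⌊2978 S/1000⌋ + 1
    have h2' : (4 : ℝ) * ((((2978 * (S : ℤ)) / 1000 : ℤ) : ℝ) + 1 - R.2.2.lo) ≤ 3 * (S : ℝ) := by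
      exact_mod_cast h2
    have hfl : (2978 : ℝ) * S / 1000 ≤ (((2978 * (S : ℤ)) / 1000 : ℤ) : ℝ) + 1 := by
      have := int_div_real_le_ediv_add_one (2978 * (S : ℤ)) (m := 1000) (by norm_num)
      push_cast at this
      linarith
    have key : ((R.2.2.lo : ℝ) / S) * S = R.2.2.lo := div_mul_cancel₀ _ hS.ne'
    have hmul : (5 / 2 + 478 / 1000 - (R.2.2.lo : ℝ) / S) * S ≤ 3 / 4 * S := by nlinarith [key, h2', hfl]
    exact le_of_mul_le_mul_right hmul hS
  · have h3' : (0 : ℝ) ≤ (S : ℝ) - R.2.1.lo := by exact_mod_cast h3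
    rw [sub_nonneg, div_le_one hS]
    linarith
  · have h1' : (eLoNum : ℝ) ≤ R.1.lo := by exact_mod_cast h1
    exact le_trans (by rw [div_le_div_iff_of_pos_right hS]; exact h1') (MI.lo_div_le S_pos ht)
  · have h4' : (R.1.hi : ℝ) + 8 * ((S : ℝ) - R.2.1.lo) ≤ eHiNum := by exact_mod_cast h4
    have hthi := MI.le_hi_div S_pos ht
    rw [show (1 : ℝ) - (R.2.1.lo : ℝ) / S = ((S : ℝ) - R.2.1.lo) / S by field_simp]
    calc ∑ j ∈ range 8, t j + 8 * (((S : ℝ) - R.2.1.lo) / S)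
        ≤ (R.1.hi : ℝ) / S + 8 * (((S : ℝ) - R.2.1.lo) / S) := by linarith
      _ = ((R.1.hi : ℝ) + 8 * ((S : ℝ) - R.2.1.lo)) / S := by ring
      _ ≤ (eHiNum : ℝ) / S := div_le_div_of_nonneg_right h4' hS.le

/-! ## Part E — the bracket data of record in the shape of the identification lemma
(`exists_critical_prolateFun_eq_frobEvenExt (hle) (hsign) (hsep) (htop)` of `ArchKernelL1Assembly`, N = 8,
`lo j = (modes[j]).chiLo/S`, `hi j = (modes[j]).chiHi/S`, written with `List.getD` and the default mode of `chainOK`) -/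

/-- `modes.getD j _` is a mode of record for `j < 8`. [cite: ConnesConsani2021, Prop. 5.3 / Lemma 5.4 §5 pp. 32–33 and §6.3–6.4 p. 24 (in-kernel certificate for the §6 kernel enclosure)] -/
theorem getD_mem_modes {j : ℕ} (hj : j < 8) (dflt : ModeData) : modes.getD j dflt ∈ modes := by
  rw [List.getD_eq_getElem _ _ (by rw [length_modes]; exact hj)]
  exact List.getElem_mem _

/-- (hle) every bracket of record is an interval, in reals. [cite: ConnesConsani2021, Prop. 5.3 / Lemma 5.4 §5 pp. 32–33 and §6.3–6.4 p. 24 (in-kernel certificate for the §6 kernel enclosure)] -/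
theorem modes_lo_le_hi (dflt : ModeData) : ∀ j < 8,
    ((modes.getD j dflt).chiLo : ℝ) / S ≤ ((modes.getD j dflt).chiHi : ℝ) / S := by
  intro j hj
  have hS : (0 : ℝ) < (S : ℝ) := by exact_mod_cast S_pos
  exact div_le_div_of_nonneg_right (by exact_mod_cast chiLo_le_chiHi_of_mem_modes (getD_mem_modes hj dflt)) hS.le

/-- (hsign) the certified end signs of `u′(0; ·)` on every bracket of record, in the weak two-sided shape.
[cite: ConnesConsani2021, Prop. 5.3 / Lemma 5.4 §5 pp. 32–33 and §6.3–6.4 p. 24 (in-kernel certificate for the §6 kernel enclosure)] -/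
theorem modes_endSigns (dflt : ModeData) : ∀ j < 8,
    (frobSol₁ 1 (((modes.getD j dflt).chiLo : ℝ) / S) 0 ≤ 0 ∧ 0 ≤ frobSol₁ 1 (((modes.getD j dflt).chiHi : ℝ) / S) 0) ∨
    (0 ≤ frobSol₁ 1 (((modes.getD j dflt).chiLo : ℝ) / S) 0 ∧ frobSol₁ 1 (((modes.getD j dflt).chiHi : ℝ) / S) 0 ≤ 0) := by
  intro j hj
  obtain ⟨hb, hok⟩ := checks_of_mem_modes (getD_mem_modes hj dflt)
  obtain ⟨-, hlo, hhi⟩ := modeTailOK_spec hok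
  have hs := endSigns_of_checks hlo hhi hb
  cases h : (modes.getD j dflt).sLo
  · obtain ⟨h1, h2⟩ := hs.2 h
    exact Or.inl ⟨h1.le, h2.le⟩
  · obtain ⟨h1, h2⟩ := hs.1 h
    exact Or.inr ⟨h1.le, h2.le⟩

/-- (hsep) consecutive brackets of record are separated: `hi j < lo (j+1)` (the `χ`-chain of `chainOK`, re-read by
`decide` on the integer data). [cite: ConnesConsani2021, Prop. 5.3 / Lemma 5.4 §5 pp. 32–33 and §6.3–6.4 p. 24 (in-kernel certificate for the §6 kernel enclosure)] -/
theorem modes_sep (dflt : ModeData) : ∀ j, j + 1 < 8 →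
    ((modes.getD j dflt).chiHi : ℝ) / S < ((modes.getD (j + 1) dflt).chiLo : ℝ) / S := by
  have hint : ∀ j < 7,
      (modes.getD j ⟨0, 0, 0, false, ⟨0, 0, 0, 0⟩⟩).chiHi < (modes.getD (j + 1) ⟨0, 0, 0, false, ⟨0, 0, 0, 0⟩⟩).chiLo := by
    decide
  intro j hj
  have hS : (0 : ℝ) < (S : ℝ) := by exact_mod_cast S_pos
  have e1 : modes.getD j dflt = modes.getD j ⟨0, 0, 0, false, ⟨0, 0, 0, 0⟩⟩ := by
    rw [List.getD_eq_getElem _ _ (by rw [length_modes]; omega), List.getD_eq_getElem _ _ (by rw [length_modes]; omega)]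
  have e2 : modes.getD (j + 1) dflt = modes.getD (j + 1) ⟨0, 0, 0, false, ⟨0, 0, 0, 0⟩⟩ := by
    rw [List.getD_eq_getElem _ _ (by rw [length_modes]; omega), List.getD_eq_getElem _ _ (by rw [length_modes]; omega)]
  rw [e1, e2]
  exact div_lt_div_of_pos_right (by exact_mod_cast hint j (by omega)) hS

/-- (htop) the last bracket lies below the Wang cap `2·8·(2·8+1) = 272` (so the eight members are the modes
`0, …, 7` by `eq_prolateFun_of_exists_index_of_eigen_strictMono`). [cite: ConnesConsani2021, Prop. 5.3 / Lemma 5.4 §5 pp. 32–33 and §6.3–6.4 p. 24 (in-kernel certificate for the §6 kernel enclosure); WangLL2010, Lemma 2.2] -/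
theorem modes_top (dflt : ModeData) : ∀ j < 8,
    ((modes.getD j dflt).chiHi : ℝ) / S < 2 * ((8 : ℕ) : ℝ) * (2 * ((8 : ℕ) : ℝ) + 1) := by
  have hint : ∀ j < 8, (modes.getD j ⟨0, 0, 0, false, ⟨0, 0, 0, 0⟩⟩).chiHi < 272 * (S : ℤ) := by
    decide
  intro j hj
  have hS : (0 : ℝ) < (S : ℝ) := by exact_mod_cast S_pos
  have e1 : modes.getD j dflt = modes.getD j ⟨0, 0, 0, false, ⟨0, 0, 0, 0⟩⟩ := by
    rw [List.getD_eq_getElem _ _ (by rw [length_modes]; omega), List.getD_eq_getElem _ _ (by rw [length_modes]; omega)]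
  rw [e1, div_lt_iff₀ hS]
  have := hint j hj
  have h' : (((modes.getD j ⟨0, 0, 0, false, ⟨0, 0, 0, 0⟩⟩).chiHi : ℤ) : ℝ) < 272 * (S : ℝ) := by exact_mod_cast this
  push_cast
  linarith

end Literature.NumberTheory.ConnesConsani2021.ArchCert

end
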